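import Literature.NumberTheory.Transcendental.TubbsPeriodsIndependenceAnalytic
import Literature.NumberTheory.Transcendental.ChudnovskyValues
import HarnessLib

/-!
# Tubbs 1990, Theorem 4 (periods form) — the values `F_p^{(t)}(ω₁/2 + n₁ω₁ + n₂ω₂)`

Topic `Literature/NumberTheory/Transcendental` (trunk T-TRANSCEND). Fourth layer of the proof of the
named fact `Literature.NumberTheory.Transcendental.Tubbs1990_thm4_periods`
(`TubbsPeriodsIndependence.lean`; R. Tubbs, J. Number Theory 35 (1990), Thm 4 p. 112 and §5).

Tubbs §5, Prop. 5.1 (p. 125) and §3, Lemma 3.1: the derivatives of the auxiliary function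
`F(z) = ∑ p_{ijk} zⁱ e^{jcz} ℘(z)ᵏ` at the points `ω₁/2 + n₁ω₁ + n₂ω₂` are values of fixed INTEGER
polynomials at the numbers `x = (ω₁/2, ω₂, c, e^{cω₁/2}, e^{cω₂}, e₁, g₂/2)` (`e₁ = ℘(ω₁/2)`), of
degree `≤ i + k + t + j(2n₁ + n₂ + 1)` and logarithmic height `O(t log(t + D) + (D + t) log X)`. This is
the shape needed for Siegel's lemma and for the norm to `ℤ[θ]` in Gel'fond's method. The file follows
`ChudnovskyAnalytic.lean` (Part II) and `ChudnovskyValues.lean` line by line, for the ring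
`ℤ[Z, U, Y, W; a₀, …, a₆]` (`Z ↔ z`, `U ↔ e^{cz}`, `Y ↔ ℘`, `W ↔ ℘′`) with the derivation
`Z′ = 1`, `U′ = a₂U`, `Y′ = W`, `W′ = 6Y² - a₆` (`a₂ ↔ c`, `a₆ ↔ g₂/2`, and
`℘″ = 6℘² - g₂/2`).

## Contents

* complex side: `tD`, `Tubbs.v`, `hasDerivAt_eval_v`, `iteratedDeriv_eval_v`, `toPoly`,
  `affF_eq_eval_toPoly`, `v_pt`;
* formal side: `R₁₁ = ℤ[Z, U, Y, W; a]`, `dval`, `D₀`, `sval n₁ n₂`, the value polynomials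
  `Wv t n₁ n₂ i j k ∈ ℤ[a₀, …, a₆]`, the numbers `xv`, and the **value formula**
  `iteratedDeriv_affF`: `F_p^{(t)}(ω₁/2 + y_n) = ∑ p_{ijk} · φx (Wv t n₁ n₂ i j k)`;
* bounds: the factorisation `D₀^t (Uʲ Q) = Uʲ · E_j^t Q` (`E_j = D₀ + j a₂`), `U`-freeness of
  `E_j^t (Zⁱ Yᵏ)`, `totalDegree_Wv_le` (`≤ j(2n₁ + n₂ + 1) + i + k + t`) and `l1_Wv_le`
  (`≤ (7(i+k+t) + j + 1)^t (2n₁ + n₂ + 2)^{i+k+t}`).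

Everything is PROVED; the definitions are the explicit formal objects.

## References

* R. Tubbs, J. Number Theory 35 (1990), §3 Lemma 3.1, §5 Prop. 5.1. [Tubbs1990]
* G. V. Chudnovsky, *Contributions to the theory of transcendental numbers* (1984), Ch. 7 §2,
  p. 306 (the ring closed under `d/dz`; `deg = O(L)`, `log H = O(L log L)`). [Chudnovsky1984]
-/

noncomputable section

open Complex MvPolynomial Finset Filter Topology
open scoped PeriodPair

namespace Literature.NumberTheory.Transcendental

namespace Tubbs

open Chudnovsky (l1 wnorm wnorm_nonneg wnorm_mul_le wnorm_add_le wnorm_sum_le wnorm_pow_le wnorm_X wnorm_C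
  wnorm_monomial e₁)

/-! ### The derivation `D_{a,b}`: `Z′ = 1`, `U′ = aU`, `Y′ = W`, `W′ = 6Y² - b` -/

section Derivation

variable {R : Type*} [CommRing R]

/-- The values of `D_{a,b}` on the variables `(Z, U, Y, W) = (X₀, X₁, X₂, X₃)`. [cite: Tubbs1990, §3 Lemma 3.1] -/
def tDVal (a b : R) : Fin 4 → MvPolynomial (Fin 4) R :=
  ![1, C a * X 1, X 3, 6 * X 2 ^ 2 - C b]

/-- The derivation `D_{a,b} = ∂_Z + aU ∂_U + W ∂_Y + (6Y² - b) ∂_W`, the algebraic form of `d/dz` on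
`R[z, e^{cz}, ℘, ℘′]`. [cite: Tubbs1990, §3 Lemma 3.1] -/
def tD (a b : R) : Derivation R (MvPolynomial (Fin 4) R) (MvPolynomial (Fin 4) R) :=
  MvPolynomial.mkDerivation R (tDVal a b)

/-- `D X_i` is the prescribed value. [folklore] -/
@[simp] theorem tD_X (a b : R) (i : Fin 4) : tD a b (X i) = tDVal a b i :=
  MvPolynomial.mkDerivation_X _ _ _

/-- `D (C r) = 0`. [folklore] -/
@[simp] theorem tD_C (a b : R) (r : R) : tD a b (C r) = 0 :=
  MvPolynomial.derivation_C _ _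

end Derivation

/-! ### The chain rule for `(z, e^{cz}, ℘, ℘′)` -/

variable (L : PeriodPair) (c : ℂ)

/-- The vector of functions `(z, e^{cz}, ℘(z), ℘′(z))`. [folklore] -/
def v (z : ℂ) : Fin 4 → ℂ := ![z, cexp (c * z), ℘[L] z, ℘'[L] z]

/-- `v 0 = z`. [folklore] -/
@[simp] theorem v_zero (z : ℂ) : v L c z 0 = z := rfl
/-- `v 1 = e^{cz}`. [folklore] -/
@[simp] theorem v_one (z : ℂ) : v L c z 1 = cexp (c * z) := rfl
/-- `v 2 = ℘`. [folklore] -/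
@[simp] theorem v_two (z : ℂ) : v L c z 2 = ℘[L] z := rfl
/-- `v 3 = ℘′`. [folklore] -/
@[simp] theorem v_three (z : ℂ) : v L c z 3 = ℘'[L] z := rfl

/-- The derivation `D = D_{c, g₂/2}` over `ℂ`. [cite: Tubbs1990, §3 Lemma 3.1] -/
abbrev Dℂ : Derivation ℂ (MvPolynomial (Fin 4) ℂ) (MvPolynomial (Fin 4) ℂ) := tD c (L.g₂ / 2)

/-- The case `i = 0` of `hasDerivAt_v`: `d/dz z = 1 = (D Z)(v z)`. [folklore] -/
theorem hasDerivAt_v_zero (z : ℂ) : HasDerivAt (fun w => v L c w 0) (eval (v L c z) (Dℂ L c (X 0))) z := by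
  have h : eval (v L c z) (Dℂ L c (X 0)) = 1 := by simp [tDVal]
  rw [h]
  exact hasDerivAt_id' z

/-- The variables satisfy the chain rule: `d/dz (v z i) = (D X_i)(v z)` off the lattice. [folklore] -/
theorem hasDerivAt_v {z : ℂ} (hz : z ∉ L.lattice) (i : Fin 4) :
    HasDerivAt (fun w => v L c w i) (eval (v L c z) (Dℂ L c (X i))) z := by
  fin_cases i
  · exact hasDerivAt_v_zero L c z
  · have h : HasDerivAt (fun w => cexp (c * w)) (cexp (c * z) * c) z :=
      (Complex.hasDerivAt_exp (c * z)).comp z (by simpa using (hasDerivAt_id z).const_mul c)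
    have : cexp (c * z) * c = eval (v L c z) (Dℂ L c (X 1)) := by simp [tDVal, mul_comm]
    simpa [this] using h
  · simpa [tDVal] using L.hasDerivAt_weierstrassP hz
  · simpa [tDVal] using L.hasDerivAt_derivWeierstrassP hz

/-- **Chain rule**: `d/dz P(z, e^{cz}, ℘, ℘′) = (D P)(z, e^{cz}, ℘, ℘′)` for `z ∉ Λ`. [cite: Tubbs1990, §3 Lemma 3.1] -/
theorem hasDerivAt_eval_v (P : MvPolynomial (Fin 4) ℂ) {z : ℂ} (hz : z ∉ L.lattice) :
    HasDerivAt (fun w => eval (v L c w) P) (eval (v L c z) (Dℂ L c P)) z := by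
  induction P using MvPolynomial.induction_on with
  | C r => simpa using hasDerivAt_const z r
  | add p q hp hq =>
    simp only [map_add]
    exact hp.add hq
  | mul_X p i hp =>
    have hi := hasDerivAt_v L c hz i
    have := hp.mul hi
    simp only [map_mul, eval_X]
    refine this.congr_deriv ?_
    rw [Derivation.leibniz]
    simp only [smul_eq_mul, map_add, map_mul, eval_X]
    ring

/-- Iterated chain rule: `(d/dz)^k P(v(z)) = (D^k P)(v(z))` for `z ∉ Λ`. [cite: Tubbs1990, §3 Lemma 3.1] -/
theorem iteratedDeriv_eval_v (k : ℕ) (P : MvPolynomial (Fin 4) ℂ) {z : ℂ} (hz : z ∉ L.lattice) :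
    iteratedDeriv k (fun w => eval (v L c w) P) z = eval (v L c z) (((Dℂ L c).toLinearMap ^ k) P) := by
  induction k generalizing z with
  | zero => simp
  | succ k ih =>
    rw [iteratedDeriv_succ, pow_succ', Module.End.mul_apply]
    have hev : iteratedDeriv k (fun w => eval (v L c w) P) =ᶠ[𝓝 z]
        fun w => eval (v L c w) (((Dℂ L c).toLinearMap ^ k) P) := by
      filter_upwards [L.isClosed_lattice.isOpen_compl.mem_nhds hz] with w hw
      exact ih hw
    rw [hev.deriv_eq]
    exact (hasDerivAt_eval_v L c _ hz).deriv

/-! ### The auxiliary function as a polynomial in `(z, e^{cz}, ℘)` -/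

variable {D L₁ : ℕ}

/-- The polynomial `∑ p_{ijk} Zⁱ Uʲ Yᵏ ∈ ℂ[Z, U, Y, W]` of a coefficient family. [folklore] -/
def toPoly (p : Coeff D L₁ → ℂ) : MvPolynomial (Fin 4) ℂ :=
  ∑ l, C (p l) * (X 0 ^ (l.1 : ℕ) * X 1 ^ (l.2.1 : ℕ) * X 2 ^ (l.2.2 : ℕ))

/-- `F_p(z) = (toPoly p)(z, e^{cz}, ℘(z), ℘′(z))`. [folklore] -/
theorem affF_eq_eval_toPoly (p : Coeff D L₁ → ℂ) (z : ℂ) : affF L c D L₁ p z = eval (v L c z) (toPoly p) := by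
  unfold affF toPoly
  simp only [map_sum, map_mul, eval_C, map_pow, eval_X, v_zero, v_one, v_two]
  refine Finset.sum_congr rfl fun l _ => ?_
  rw [← Complex.exp_nat_mul]

/-- `v(ω₁/2 + y_n) = (ω₁/2 + y_n, e^{c(ω₁/2 + y_n)}, e₁, 0)`. [folklore] -/
theorem v_pt (n₁ n₂ : ℕ) :
    v L c (L.ω₁ / 2 + latt L n₁ n₂) = ![L.ω₁ / 2 + latt L n₁ n₂, cexp (c * (L.ω₁ / 2 + latt L n₁ n₂)), e₁ L, 0] := by
  have hmem : latt L n₁ n₂ ∈ L.lattice := latt_mem_lattice L n₁ n₂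
  ext i
  fin_cases i
  · rfl
  · rfl
  · show ℘[L] (L.ω₁ / 2 + latt L n₁ n₂) = e₁ L
    have := L.weierstrassP_add_coe (L.ω₁ / 2) ⟨_, hmem⟩
    simpa [Chudnovsky.e₁] using this
  · show ℘'[L] (L.ω₁ / 2 + latt L n₁ n₂) = 0
    have := L.derivWeierstrassP_add_coe (L.ω₁ / 2) ⟨_, hmem⟩
    rw [Submodule.coe_mk] at this
    rw [this]
    exact Chudnovsky.derivWeierstrassP_ω₁_div_two L

/-- The derivatives of `F_p` at `ω₁/2 + y_n` as values of `D^t`-images. [cite: Tubbs1990, §3 Lemma 3.1] -/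
theorem iteratedDeriv_affF_eq_sum (p : Coeff D L₁ → ℂ) (t n₁ n₂ : ℕ) :
    iteratedDeriv t (affF L c D L₁ p) (L.ω₁ / 2 + latt L n₁ n₂) =
      ∑ l, p l * eval ![L.ω₁ / 2 + latt L n₁ n₂, cexp (c * (L.ω₁ / 2 + latt L n₁ n₂)), e₁ L, 0]
        (((Dℂ L c).toLinearMap ^ t) (X 0 ^ (l.1 : ℕ) * X 1 ^ (l.2.1 : ℕ) * X 2 ^ (l.2.2 : ℕ))) := by
  have hF : affF L c D L₁ p = fun w => eval (v L c w) (toPoly p) := funext (affF_eq_eval_toPoly L c p)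
  rw [hF, iteratedDeriv_eval_v L c t _ (halfPeriod_add_latt_notMem L n₁ n₂), v_pt]
  unfold toPoly
  simp only [map_sum]
  refine Finset.sum_congr rfl fun l _ => ?_
  have : C (p l) * (X 0 ^ (l.1 : ℕ) * X 1 ^ (l.2.1 : ℕ) * X 2 ^ (l.2.2 : ℕ)) =
      p l • (X 0 ^ (l.1 : ℕ) * X 1 ^ (l.2.1 : ℕ) * X 2 ^ (l.2.2 : ℕ) : MvPolynomial (Fin 4) ℂ) := by
    rw [smul_eq_C_mul]
  rw [this, map_smul, smul_eq_C_mul, map_mul, eval_C]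

/-! ### The formal side: integer polynomials in `(Z, U, Y, W; a₀, …, a₆)` -/

/-- The coefficient ring `P₇ = ℤ[a₀, …, a₆]`
(`a₀ ↔ ω₁/2`, `a₁ ↔ ω₂`, `a₂ ↔ c`, `a₃ ↔ e^{cω₁/2}`, `a₄ ↔ e^{cω₂}`, `a₅ ↔ e₁`, `a₆ ↔ g₂/2`). [folklore] -/
abbrev P₇ : Type := MvPolynomial (Fin 7) ℤ

/-- The flat formal ring `R₁₁ = ℤ[Z, U, Y, W; a₀, …, a₆]`. [folklore] -/
abbrev R₁₁ : Type := MvPolynomial (Fin 4 ⊕ Fin 7) ℤ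

/-- The values of the formal derivation: `Z′ = 1`, `U′ = a₂U`, `Y′ = W`, `W′ = 6Y² - a₆`, `a′ = 0`.
[cite: Tubbs1990, §3 Lemma 3.1] -/
def dval : Fin 4 ⊕ Fin 7 → R₁₁ :=
  Sum.elim ![1, X (Sum.inr 2) * X (Sum.inl 1), X (Sum.inl 3), 6 * X (Sum.inl 2) ^ 2 - X (Sum.inr 6)] 0

/-- The formal derivation `D₀` of `ℤ[Z, U, Y, W; a]`. [cite: Tubbs1990, §3 Lemma 3.1] -/
def D₀ : Derivation ℤ R₁₁ R₁₁ := MvPolynomial.mkDerivation ℤ dval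

/-- `D₀ X_s = dval s`. [folklore] -/
@[simp] theorem D₀_X (s : Fin 4 ⊕ Fin 7) : D₀ (X s) = dval s := MvPolynomial.mkDerivation_X _ _ _

/-- The substitution at the point `ω₁/2 + n₁ω₁ + n₂ω₂`: `Z ↦ (2n₁+1)a₀ + n₂a₁`,
`U ↦ a₃^{2n₁+1} a₄^{n₂}`, `Y ↦ a₅`, `W ↦ 0`, `a ↦ a`. [folklore] -/
def sval (n₁ n₂ : ℕ) : Fin 4 ⊕ Fin 7 → P₇ :=
  Sum.elim ![C ((2 * n₁ + 1 : ℕ) : ℤ) * X 0 + C (n₂ : ℤ) * X 1, X 3 ^ (2 * n₁ + 1) * X 4 ^ n₂, X 5, 0] X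

/-- The same substitution with `U ↦ 0` (used on `U`-free polynomials; all values of degree `≤ 1`). [folklore] -/
def sval₀ (n₁ n₂ : ℕ) : Fin 4 ⊕ Fin 7 → P₇ :=
  Sum.elim ![C ((2 * n₁ + 1 : ℕ) : ℤ) * X 0 + C (n₂ : ℤ) * X 1, 0, X 5, 0] X

/-- **The value polynomials** `Wv t n₁ n₂ i j k = (D₀^t (Zⁱ Uʲ Yᵏ))((2n₁+1)a₀ + n₂a₁, a₃^{2n₁+1}a₄^{n₂}, a₅, 0; a)`:
the formal values of `(d/dz)^t (zⁱ e^{jcz} ℘ᵏ)` at `ω₁/2 + n₁ω₁ + n₂ω₂`. [cite: Tubbs1990, §3 Lemma 3.1] -/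
def Wv (t n₁ n₂ i j k : ℕ) : P₇ :=
  MvPolynomial.aeval (sval n₁ n₂) ((D₀.toLinearMap ^ t) (X (Sum.inl 0) ^ i * X (Sum.inl 1) ^ j * X (Sum.inl 2) ^ k))

/-- The numbers `x = (ω₁/2, ω₂, c, e^{cω₁/2}, e^{cω₂}, e₁, g₂/2)`. [folklore] -/
def xv : Fin 7 → ℂ := ![L.ω₁ / 2, L.ω₂, c, cexp (c * (L.ω₁ / 2)), cexp (c * L.ω₂), e₁ L, L.g₂ / 2]

/-- The specialisation `ℤ[a] → ℂ`, `a ↦ x`. [folklore] -/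
abbrev φx : P₇ →+* ℂ := (MvPolynomial.aeval (xv L c) : P₇ →ₐ[ℤ] ℂ).toRingHom

/-- The specialisation of the constants `ℤ[X; a] → ℂ[X]`. [folklore] -/
abbrev ψx : R₁₁ →ₐ[ℤ] MvPolynomial (Fin 4) ℂ := MvPolynomial.aeval (Sum.elim X fun l => C (xv L c l))

/-- `ψx` intertwines the values of the two derivations on the variables. [folklore] -/
theorem ψx_dval (s : Fin 4 ⊕ Fin 7) : ψx L c (dval s) = Dℂ L c (ψx L c (X s)) := by
  rcases s with s | l
  · fin_cases s <;> simp [dval, tDVal, xv, map_sub]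
  · simp [dval]

/-- **Specialisation commutes with derivation**: `ψx (D₀ Q) = D (ψx Q)`. [folklore] -/
theorem ψx_D₀ (Q : R₁₁) : ψx L c (D₀ Q) = Dℂ L c (ψx L c Q) := by
  induction Q using MvPolynomial.induction_on with
  | C r =>
    rw [D₀, MvPolynomial.derivation_C, map_zero, MvPolynomial.aeval_C, eq_intCast, Derivation.map_intCast]
  | add p q hp hq => simp only [map_add, hp, hq]
  | mul_X p s hp =>
    rw [Derivation.leibniz, smul_eq_mul, smul_eq_mul, map_add, map_mul, map_mul, hp, D₀_X, ψx_dval, map_mul,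
      (Dℂ L c).leibniz, smul_eq_mul, smul_eq_mul]

/-- The same for the iterates. [folklore] -/
theorem ψx_D₀_pow (t : ℕ) (Q : R₁₁) :
    ψx L c ((D₀.toLinearMap ^ t) Q) = ((Dℂ L c).toLinearMap ^ t) (ψx L c Q) := by
  induction t generalizing Q with
  | zero => simp
  | succ t ih =>
    rw [pow_succ, pow_succ, Module.End.mul_apply, Module.End.mul_apply, ih]
    exact congrArg _ (ψx_D₀ L c Q)

/-- `e^{c(ω₁/2 + y_n)} = (e^{cω₁/2})^{2n₁+1} (e^{cω₂})^{n₂}`. [folklore] -/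
theorem cexp_pt (n₁ n₂ : ℕ) :
    cexp (c * (L.ω₁ / 2 + latt L n₁ n₂)) = cexp (c * (L.ω₁ / 2)) ^ (2 * n₁ + 1) * cexp (c * L.ω₂) ^ n₂ := by
  rw [← Complex.exp_nat_mul, ← Complex.exp_nat_mul, ← Complex.exp_add, latt]
  congr 1
  push_cast
  ring

/-- Compatibility of the two evaluations at `ω₁/2 + y_n`. [folklore] -/
theorem φx_aeval_sval (n₁ n₂ : ℕ) (Q : R₁₁) :
    φx L c (MvPolynomial.aeval (sval n₁ n₂) Q) =
      eval ![L.ω₁ / 2 + latt L n₁ n₂, cexp (c * (L.ω₁ / 2 + latt L n₁ n₂)), e₁ L, 0] (ψx L c Q) := by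
  change ((φx L c).comp (MvPolynomial.aeval (sval n₁ n₂) : R₁₁ →ₐ[ℤ] P₇).toRingHom) Q =
    ((MvPolynomial.eval ![L.ω₁ / 2 + latt L n₁ n₂, cexp (c * (L.ω₁ / 2 + latt L n₁ n₂)), e₁ L, 0]).comp
      (ψx L c).toRingHom) Q
  congr 1
  refine MvPolynomial.ringHom_ext (fun r => by simp) (fun s => ?_)
  rcases s with s | l
  · fin_cases s
    · simp [sval, xv, latt]; ring
    · simp [sval, xv, cexp_pt]
    · simp [sval, xv]
    · simp [sval, xv]
  · fin_cases l <;> simp [sval, xv]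

/-- Specialising the formal value gives the complex value. [folklore] -/
theorem φx_Wv (t n₁ n₂ i j k : ℕ) :
    φx L c (Wv t n₁ n₂ i j k) = eval ![L.ω₁ / 2 + latt L n₁ n₂, cexp (c * (L.ω₁ / 2 + latt L n₁ n₂)), e₁ L, 0]
      (((Dℂ L c).toLinearMap ^ t) (X 0 ^ i * X 1 ^ j * X 2 ^ k)) := by
  unfold Wv
  rw [φx_aeval_sval, ψx_D₀_pow]
  congr 2
  simp [map_mul, map_pow]

/-- **Value formula.** `F_p^{(t)}(ω₁/2 + n₁ω₁ + n₂ω₂) = ∑ p_{ijk} · φx (Wv t n₁ n₂ i j k)`: the derivatives of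
the auxiliary function at the points are the specialisations at
`x = (ω₁/2, ω₂, c, e^{cω₁/2}, e^{cω₂}, e₁, g₂/2)` of fixed integer polynomials.
[cite: Tubbs1990, §3 Lemma 3.1, §5 Prop. 5.1] -/
theorem iteratedDeriv_affF (p : Coeff D L₁ → ℂ) (t n₁ n₂ : ℕ) :
    iteratedDeriv t (affF L c D L₁ p) (L.ω₁ / 2 + latt L n₁ n₂) = ∑ l, p l * φx L c (Wv t n₁ n₂ l.1 l.2.1 l.2.2) := by
  rw [iteratedDeriv_affF_eq_sum]
  simp_rw [φx_Wv]


/-! ### Degrees and heights of the value polynomials -/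

section Bounds

/-- The values of `D₀` on the variables have degree `≤ 2`. [folklore] -/
theorem totalDegree_dval_le (s : Fin 4 ⊕ Fin 7) : (dval s).totalDegree ≤ 2 := by
  rcases s with s | l
  · fin_cases s
    · change (1 : R₁₁).totalDegree ≤ 2
      rw [totalDegree_one]; norm_num
    · change (X (Sum.inr 2) * X (Sum.inl 1) : R₁₁).totalDegree ≤ 2
      refine (totalDegree_mul _ _).trans ?_
      rw [totalDegree_X, totalDegree_X]
    · change (X (Sum.inl 3) : R₁₁).totalDegree ≤ 2
      rw [totalDegree_X]; norm_num
    · change (6 * X (Sum.inl 2) ^ 2 - X (Sum.inr 6) : R₁₁).totalDegree ≤ 2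
      refine (totalDegree_sub _ _).trans (max_le ?_ ?_)
      · refine (totalDegree_mul _ _).trans ?_
        rw [show (6 : R₁₁) = C 6 from (map_ofNat C 6).symm, totalDegree_C, totalDegree_X_pow]
      · rw [totalDegree_X]; norm_num
  · change (0 : R₁₁).totalDegree ≤ 2
    rw [totalDegree_zero]; norm_num

/-- The values of `D₀` on the variables have `ℓ¹`-norm `≤ 7`. [folklore] -/
theorem l1_dval_le (s : Fin 4 ⊕ Fin 7) : l1 (dval s) ≤ 7 := by
  rcases s with s | l
  · fin_cases s
    · change l1 (1 : R₁₁) ≤ 7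
      rw [l1, Chudnovsky.wnorm_one, Chudnovsky.normRingSeminorm_int_one]; norm_num
    · change l1 (X (Sum.inr 2) * X (Sum.inl 1) : R₁₁) ≤ 7
      refine (wnorm_mul_le _ _ _).trans ?_
      rw [wnorm_X, wnorm_X, Chudnovsky.normRingSeminorm_int_one]; norm_num
    · change l1 (X (Sum.inl 3) : R₁₁) ≤ 7
      rw [l1, wnorm_X, Chudnovsky.normRingSeminorm_int_one]; norm_num
    · change l1 (6 * X (Sum.inl 2) ^ 2 - X (Sum.inr 6) : R₁₁) ≤ 7
      refine (Chudnovsky.wnorm_sub_le _ _ _).trans ?_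
      have h6 : l1 (6 * X (Sum.inl 2) ^ 2 : R₁₁) ≤ 6 := by
        refine (wnorm_mul_le _ _ _).trans ?_
        rw [show (6 : R₁₁) = C 6 from (map_ofNat C 6).symm, wnorm_C, Chudnovsky.normRingSeminorm_int_apply]
        have := Chudnovsky.wnorm_X_pow_le (normRingSeminorm ℤ) (by simp) (Sum.inl 2 : Fin 4 ⊕ Fin 7) 2
        have h0 := wnorm_nonneg (normRingSeminorm ℤ) ((X (Sum.inl 2) : R₁₁) ^ 2)
        norm_num
        nlinarith
      have hX : l1 (X (Sum.inr 6) : R₁₁) = 1 := by rw [l1, wnorm_X, Chudnovsky.normRingSeminorm_int_one]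
      unfold l1 at h6 hX
      linarith
  · change l1 (0 : R₁₁) ≤ 7
    rw [l1, Chudnovsky.wnorm_zero]; norm_num

/-- **The twisted operator** `E_j = D₀ + j·a₂`: `D₀ (Uʲ Q) = Uʲ · E_j Q`. [folklore] -/
def Eop (j : ℕ) (Q : R₁₁) : R₁₁ := D₀ Q + C (j : ℤ) * (X (Sum.inr 2) * Q)

/-- `D₀ (Uʲ Q) = Uʲ E_j Q` (Leibniz and `U′ = a₂U`). [folklore] -/
theorem D₀_Upow_mul (j : ℕ) (Q : R₁₁) : D₀ (X (Sum.inl 1) ^ j * Q) = X (Sum.inl 1) ^ j * Eop j Q := by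
  rw [Derivation.leibniz, Derivation.leibniz_pow, D₀_X, Eop]
  change (X (Sum.inl 1) ^ j : R₁₁) * D₀ Q + Q * (j • ((X (Sum.inl 1) : R₁₁) ^ (j - 1) * (X (Sum.inr 2) * X (Sum.inl 1)))) = _
  rcases Nat.eq_zero_or_pos j with rfl | hj
  · simp
  · have hpow : (X (Sum.inl 1) : R₁₁) ^ j = X (Sum.inl 1) ^ (j - 1) * X (Sum.inl 1) := by
      rw [← pow_succ, Nat.sub_add_cancel hj]
    rw [nsmul_eq_mul, ← map_natCast C j, hpow, mul_add]
    ring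

/-- `D₀^t (Uʲ Q) = Uʲ · E_j^t Q`. [folklore] -/
theorem D₀pow_Upow_mul (t j : ℕ) (Q : R₁₁) :
    (D₀.toLinearMap ^ t) (X (Sum.inl 1) ^ j * Q) = X (Sum.inl 1) ^ j * ((Eop j)^[t] Q) := by
  induction t with
  | zero => simp
  | succ t ih =>
    rw [pow_succ', Module.End.mul_apply, ih, Function.iterate_succ_apply']
    exact D₀_Upow_mul j _

/-- `U`-freeness: the variable `U` does not occur. [folklore] -/
def UFree (Q : R₁₁) : Prop := Q.degreeOf (Sum.inl 1) = 0

/-- Characterisation by supports. [folklore] -/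
theorem uFree_iff (Q : R₁₁) : UFree Q ↔ ∀ m ∈ Q.support, m (Sum.inl 1) = 0 := by
  rw [UFree, ← Nat.le_zero, degreeOf_le_iff]
  simp only [Nat.le_zero]

/-- `dval s` is `U`-free for `s ≠ U`. [folklore] -/
theorem uFree_dval {s : Fin 4 ⊕ Fin 7} (hs : s ≠ Sum.inl 1) : UFree (dval s) := by
  classical
  rcases s with s | l
  · fin_cases s
    · change degreeOf _ (1 : R₁₁) = 0
      exact degreeOf_one _
    · exact absurd rfl hs
    · change degreeOf _ (X (Sum.inl 3) : R₁₁) = 0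
      rw [degreeOf_X]; simp
    · change degreeOf _ (6 * X (Sum.inl 2) ^ 2 - X (Sum.inr 6) : R₁₁) = 0
      refine Nat.le_zero.mp ((degreeOf_sub_le _ _ _).trans (max_le ?_ ?_))
      · refine (degreeOf_mul_le _ _ _).trans ?_
        rw [show (6 : R₁₁) = C 6 from (map_ofNat C 6).symm, degreeOf_C, zero_add]
        refine (degreeOf_pow_le _ _ _).trans ?_
        rw [degreeOf_X]; simp
      · rw [degreeOf_X]; simp
  · change degreeOf _ (0 : R₁₁) = 0
    exact degreeOf_zero _

/-- `U`-freeness is preserved by `D₀`. [folklore] -/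
theorem uFree_D₀ {Q : R₁₁} (hQ : UFree Q) : UFree (D₀ Q) := by
  classical
  have hQ' := (uFree_iff Q).mp hQ
  rw [UFree, ← Nat.le_zero]
  conv_lhs => rw [Q.as_sum, map_sum]
  refine (degreeOf_sum_le _ _ _).trans (Finset.sup_le fun α hα => ?_)
  rw [D₀, MvPolynomial.mkDerivation_monomial, Finsupp.sum, MvPolynomial.smul_eq_C_mul]
  refine (degreeOf_C_mul_le _ _ _).trans ((degreeOf_sum_le _ _ _).trans (Finset.sup_le fun s hs => ?_))
  rw [smul_eq_mul]
  have hsU : s ≠ Sum.inl 1 := by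
    rintro rfl
    exact (Finsupp.mem_support_iff.mp hs) (hQ' α hα)
  refine (degreeOf_mul_le _ _ _).trans ?_
  have h1 : degreeOf (Sum.inl 1) (monomial (α - Finsupp.single s 1) ((α s : ℕ) : ℤ) : R₁₁) ≤ 0 := by
    rw [degreeOf_le_iff]
    intro m hm
    have := support_monomial_subset hm
    rw [Finset.mem_singleton] at this
    rw [this, Finsupp.tsub_apply, hQ' α hα, Nat.zero_sub]
  have h2 : degreeOf (Sum.inl 1) (dval s) = 0 := uFree_dval hsU
  omega

/-- `U`-freeness is preserved by `E_j`. [folklore] -/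
theorem uFree_Eop {Q : R₁₁} (hQ : UFree Q) (j : ℕ) : UFree (Eop j Q) := by
  classical
  rw [UFree, ← Nat.le_zero, Eop]
  refine (degreeOf_add_le _ _ _).trans (max_le (Nat.le_zero.mpr (uFree_D₀ hQ)) ?_)
  refine (degreeOf_C_mul_le _ _ _).trans ((degreeOf_mul_le _ _ _).trans ?_)
  rw [degreeOf_X, if_neg (by decide), zero_add]
  exact Nat.le_zero.mpr hQ

/-- `U`-freeness is preserved by the iterates of `E_j`. [folklore] -/
theorem uFree_Eop_iterate {Q : R₁₁} (hQ : UFree Q) (j t : ℕ) : UFree ((Eop j)^[t] Q) := by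
  induction t with
  | zero => simpa using hQ
  | succ t ih => rw [Function.iterate_succ_apply']; exact uFree_Eop ih j

/-- `Zⁱ Yᵏ` is `U`-free. [folklore] -/
theorem uFree_ZY (i k : ℕ) : UFree (X (Sum.inl 0) ^ i * X (Sum.inl 2) ^ k : R₁₁) := by
  classical
  rw [UFree, ← Nat.le_zero]
  refine (degreeOf_mul_le _ _ _).trans ?_
  have h1 := degreeOf_pow_le (Sum.inl 1 : Fin 4 ⊕ Fin 7) (X (Sum.inl 0) : R₁₁) i
  have h2 := degreeOf_pow_le (Sum.inl 1 : Fin 4 ⊕ Fin 7) (X (Sum.inl 2) : R₁₁) k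
  rw [degreeOf_X, if_neg (by decide), mul_zero] at h1 h2
  omega

/-- On `U`-free polynomials the two substitutions agree. [folklore] -/
theorem aeval_sval_eq_of_uFree (n₁ n₂ : ℕ) {Q : R₁₁} (hQ : UFree Q) :
    MvPolynomial.aeval (sval n₁ n₂) Q = MvPolynomial.aeval (sval₀ n₁ n₂) Q := by
  change (MvPolynomial.aeval (sval n₁ n₂) : R₁₁ →ₐ[ℤ] P₇).toRingHom Q = (MvPolynomial.aeval (sval₀ n₁ n₂) : R₁₁ →ₐ[ℤ] P₇).toRingHom Q
  refine MvPolynomial.hom_congr_vars (by ext; simp) (fun s hs _ => ?_) rfl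
  have hsU : s ≠ Sum.inl 1 := by
    rintro rfl
    exact (mem_vars_iff_degreeOf_ne_zero.mp hs) hQ
  rcases s with s | l
  · fin_cases s
    · simp [sval, sval₀]
    · exact absurd rfl hsU
    · simp [sval, sval₀]
    · simp [sval, sval₀]
  · simp [sval, sval₀]

/-- The substitution `sval₀` has values of degree `≤ 1`. [folklore] -/
theorem totalDegree_sval₀_le (n₁ n₂ : ℕ) (s : Fin 4 ⊕ Fin 7) : (sval₀ n₁ n₂ s).totalDegree ≤ 1 := by
  rcases s with s | l
  · fin_cases s
    · change (C ((2 * n₁ + 1 : ℕ) : ℤ) * X 0 + C (n₂ : ℤ) * X 1 : P₇).totalDegree ≤ 1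
      refine (totalDegree_add _ _).trans (max_le ?_ ?_) <;>
        refine (totalDegree_mul _ _).trans ?_ <;> rw [totalDegree_C, totalDegree_X]
    · change (0 : P₇).totalDegree ≤ 1
      rw [totalDegree_zero]; norm_num
    · change (X 5 : P₇).totalDegree ≤ 1
      rw [totalDegree_X]
    · change (0 : P₇).totalDegree ≤ 1
      rw [totalDegree_zero]; norm_num
  · change (X l : P₇).totalDegree ≤ 1
    rw [totalDegree_X]

/-- The substitution `sval₀ n` has values of `ℓ¹`-norm `≤ 2n₁ + n₂ + 2`. [folklore] -/
theorem l1_sval₀_le (n₁ n₂ : ℕ) (s : Fin 4 ⊕ Fin 7) : l1 (sval₀ n₁ n₂ s) ≤ 2 * (n₁ : ℝ) + n₂ + 2 := by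
  have hn₁ : (0 : ℝ) ≤ n₁ := Nat.cast_nonneg n₁
  have hn₂ : (0 : ℝ) ≤ n₂ := Nat.cast_nonneg n₂
  rcases s with s | l
  · fin_cases s
    · change l1 (C ((2 * n₁ + 1 : ℕ) : ℤ) * X 0 + C (n₂ : ℤ) * X 1 : P₇) ≤ _
      refine (wnorm_add_le _ _ _).trans ?_
      have h1 : wnorm (normRingSeminorm ℤ) (C ((2 * n₁ + 1 : ℕ) : ℤ) * X 0 : P₇) ≤ 2 * n₁ + 1 := by
        refine (wnorm_mul_le _ _ _).trans ?_
        rw [wnorm_C, wnorm_X, Chudnovsky.normRingSeminorm_int_apply, Chudnovsky.normRingSeminorm_int_one,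
          mul_one, Int.cast_natCast, Nat.abs_cast]
        push_cast
        exact le_rfl
      have h2 : wnorm (normRingSeminorm ℤ) (C (n₂ : ℤ) * X 1 : P₇) ≤ n₂ := by
        refine (wnorm_mul_le _ _ _).trans ?_
        rw [wnorm_C, wnorm_X, Chudnovsky.normRingSeminorm_int_apply, Chudnovsky.normRingSeminorm_int_one,
          mul_one, Int.cast_natCast, Nat.abs_cast]
      linarith
    · change l1 (0 : P₇) ≤ _
      rw [l1, Chudnovsky.wnorm_zero]; linarith
    · change l1 (X 5 : P₇) ≤ _
      rw [l1, wnorm_X, Chudnovsky.normRingSeminorm_int_one]; linarith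
    · change l1 (0 : P₇) ≤ _
      rw [l1, Chudnovsky.wnorm_zero]; linarith
  · change l1 (X l : P₇) ≤ _
    rw [l1, wnorm_X, Chudnovsky.normRingSeminorm_int_one]; linarith

/-- Degree under `E_j`: `deg (E_j Q) ≤ deg Q + 1`. [folklore] -/
theorem totalDegree_Eop_le (j : ℕ) (Q : R₁₁) : (Eop j Q).totalDegree ≤ Q.totalDegree + 1 := by
  rw [Eop]
  refine (totalDegree_add _ _).trans (max_le ?_ ?_)
  · exact Chudnovsky.totalDegree_mkDerivation_le dval totalDegree_dval_le Q
  · refine (totalDegree_mul _ _).trans ?_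
    rw [totalDegree_C, zero_add]
    refine (totalDegree_mul _ _).trans ?_
    rw [totalDegree_X]; omega

/-- Degree of the iterates: `deg (E_j^t Q) ≤ deg Q + t`. [folklore] -/
theorem totalDegree_Eop_iterate_le (j t : ℕ) (Q : R₁₁) : ((Eop j)^[t] Q).totalDegree ≤ Q.totalDegree + t := by
  induction t with
  | zero => simp
  | succ t ih =>
    rw [Function.iterate_succ_apply']
    exact (totalDegree_Eop_le j _).trans (by omega)

/-- Height under `E_j`: `l1 (E_j Q) ≤ (7 deg Q + j) l1 Q`. [folklore] -/
theorem l1_Eop_le (j : ℕ) (Q : R₁₁) : l1 (Eop j Q) ≤ (7 * Q.totalDegree + j) * l1 Q := by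
  rw [Eop]
  refine (wnorm_add_le _ _ _).trans ?_
  have h1 : l1 (D₀ Q) ≤ 7 * Q.totalDegree * l1 Q := Chudnovsky.l1_mkDerivation_le dval (by norm_num) l1_dval_le Q
  have h2 : wnorm (normRingSeminorm ℤ) (C (j : ℤ) * (X (Sum.inr 2) * Q) : R₁₁) ≤ j * l1 Q := by
    refine (wnorm_mul_le _ _ _).trans ?_
    rw [wnorm_C, Chudnovsky.normRingSeminorm_int_apply]
    refine mul_le_mul (by simp) ((wnorm_mul_le _ _ _).trans ?_) (wnorm_nonneg _ _) (by positivity)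
    rw [wnorm_X, Chudnovsky.normRingSeminorm_int_one, one_mul]
  unfold l1 at h1 ⊢
  linarith

/-- Height of the iterates: `l1 (E_j^t Q) ≤ (7 (deg Q + t) + j)^t · l1 Q`. [folklore] -/
theorem l1_Eop_iterate_le (j t : ℕ) (Q : R₁₁) :
    l1 ((Eop j)^[t] Q) ≤ (7 * ((Q.totalDegree : ℝ) + t) + j) ^ t * l1 Q := by
  induction t with
  | zero => simp
  | succ t ih =>
    rw [Function.iterate_succ_apply']
    set P := (Eop j)^[t] Q
    have hdeg : (P.totalDegree : ℝ) ≤ Q.totalDegree + t := by exact_mod_cast totalDegree_Eop_iterate_le j t Q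
    have hl1P : 0 ≤ l1 P := wnorm_nonneg _ _
    have hl1Q : 0 ≤ l1 Q := wnorm_nonneg _ _
    calc l1 (Eop j P) ≤ (7 * P.totalDegree + j) * l1 P := l1_Eop_le j P
      _ ≤ (7 * ((Q.totalDegree : ℝ) + t) + j) * ((7 * ((Q.totalDegree : ℝ) + t) + j) ^ t * l1 Q) := by gcongr
      _ ≤ (7 * ((Q.totalDegree : ℝ) + (t + 1 : ℕ)) + j) ^ (t + 1) * l1 Q := by
          rw [pow_succ]
          have h0 : 0 ≤ 7 * ((Q.totalDegree : ℝ) + t) + j := by positivity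
          have h1 : 7 * ((Q.totalDegree : ℝ) + t) + j ≤ 7 * ((Q.totalDegree : ℝ) + (t + 1 : ℕ)) + j := by
            push_cast; linarith
          calc (7 * ((Q.totalDegree : ℝ) + t) + j) * ((7 * ((Q.totalDegree : ℝ) + t) + j) ^ t * l1 Q)
              = (7 * ((Q.totalDegree : ℝ) + t) + j) ^ t * (7 * ((Q.totalDegree : ℝ) + t) + j) * l1 Q := by ring
            _ ≤ (7 * ((Q.totalDegree : ℝ) + (t + 1 : ℕ)) + j) ^ t * (7 * ((Q.totalDegree : ℝ) + (t + 1 : ℕ)) + j) * l1 Q := by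
                gcongr

/-- **The factorised value polynomial**: `Wv = (a₃^{2n₁+1}a₄^{n₂})ʲ · (E_j^t (ZⁱYᵏ))(sval₀)`. [folklore] -/
theorem Wv_eq (t n₁ n₂ i j k : ℕ) :
    Wv t n₁ n₂ i j k = (X 3 ^ (2 * n₁ + 1) * X 4 ^ n₂ : P₇) ^ j *
      MvPolynomial.aeval (sval₀ n₁ n₂) ((Eop j)^[t] (X (Sum.inl 0) ^ i * X (Sum.inl 2) ^ k)) := by
  rw [Wv, show (X (Sum.inl 0) ^ i * X (Sum.inl 1) ^ j * X (Sum.inl 2) ^ k : R₁₁) =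
      X (Sum.inl 1) ^ j * (X (Sum.inl 0) ^ i * X (Sum.inl 2) ^ k) by ring, D₀pow_Upow_mul, map_mul, map_pow,
    aeval_sval_eq_of_uFree n₁ n₂ (uFree_Eop_iterate (uFree_ZY i k) j t)]
  congr 1
  simp [sval]

/-- **Degree bound**: `deg (Wv t n₁ n₂ i j k) ≤ j (2n₁ + n₂ + 1) + (i + k + t)`. [cite: Chudnovsky1984, Ch. 7 §2 p. 306] -/
theorem totalDegree_Wv_le (t n₁ n₂ i j k : ℕ) :
    (Wv t n₁ n₂ i j k).totalDegree ≤ j * (2 * n₁ + n₂ + 1) + (i + k + t) := by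
  rw [Wv_eq]
  refine (totalDegree_mul _ _).trans (add_le_add ?_ ?_)
  · refine (totalDegree_pow _ _).trans ?_
    have h : (X 3 ^ (2 * n₁ + 1) * X 4 ^ n₂ : P₇).totalDegree ≤ 2 * n₁ + n₂ + 1 :=
      (totalDegree_mul _ _).trans (by rw [totalDegree_X_pow, totalDegree_X_pow]; omega)
    exact Nat.mul_le_mul_left j h
  · refine (Chudnovsky.totalDegree_aeval_le_of_le_one (sval₀ n₁ n₂) (totalDegree_sval₀_le n₁ n₂)
      ((Eop j)^[t] (X (Sum.inl 0) ^ i * X (Sum.inl 2) ^ k))).trans ?_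
    refine (totalDegree_Eop_iterate_le j t _).trans ?_
    have : (X (Sum.inl 0) ^ i * X (Sum.inl 2) ^ k : R₁₁).totalDegree ≤ i + k :=
      (totalDegree_mul _ _).trans (by rw [totalDegree_X_pow, totalDegree_X_pow])
    omega

/-- The same, monomial-wise. [folklore] -/
theorem degree_le_of_mem_support_Wv (t n₁ n₂ i j k : ℕ) {α : Fin 7 →₀ ℕ} (hα : α ∈ (Wv t n₁ n₂ i j k).support) :
    α.degree ≤ j * (2 * n₁ + n₂ + 1) + (i + k + t) :=
  (le_totalDegree hα : α.degree ≤ (Wv t n₁ n₂ i j k).totalDegree).trans (totalDegree_Wv_le t n₁ n₂ i j k)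

/-- **Height bound**: `l1 (Wv t n₁ n₂ i j k) ≤ (7 (i+k+t) + j)^t (2n₁ + n₂ + 2)^{i+k+t}`.
[cite: Chudnovsky1984, Ch. 7 §2 p. 306] -/
theorem l1_Wv_le (t n₁ n₂ i j k : ℕ) :
    l1 (Wv t n₁ n₂ i j k) ≤ (7 * ((i : ℝ) + k + t) + j) ^ t * (2 * (n₁ : ℝ) + n₂ + 2) ^ (i + k + t) := by
  rw [Wv_eq]
  set Q : R₁₁ := X (Sum.inl 0) ^ i * X (Sum.inl 2) ^ k with hQ
  set P : R₁₁ := (Eop j)^[t] Q with hP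
  have hM : (1 : ℝ) ≤ 2 * (n₁ : ℝ) + n₂ + 2 := by
    have := (Nat.cast_nonneg n₁ : (0 : ℝ) ≤ n₁); have := (Nat.cast_nonneg n₂ : (0 : ℝ) ≤ n₂); linarith
  have hQdeg : Q.totalDegree ≤ i + k := (totalDegree_mul _ _).trans (by rw [totalDegree_X_pow, totalDegree_X_pow])
  have hdegP : P.totalDegree ≤ i + k + t := (totalDegree_Eop_iterate_le j t Q).trans (by omega)
  have hQl1 : l1 Q ≤ 1 := by
    refine (wnorm_mul_le _ _ _).trans ?_
    have h1 := Chudnovsky.wnorm_X_pow_le (normRingSeminorm ℤ) (by simp) (Sum.inl 0 : Fin 4 ⊕ Fin 7) i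
    have h2 := Chudnovsky.wnorm_X_pow_le (normRingSeminorm ℤ) (by simp) (Sum.inl 2 : Fin 4 ⊕ Fin 7) k
    have h0 := wnorm_nonneg (normRingSeminorm ℤ) ((X (Sum.inl 0) : R₁₁) ^ i)
    nlinarith
  have hl1P : l1 P ≤ (7 * ((i : ℝ) + k + t) + j) ^ t := by
    refine (l1_Eop_iterate_le j t Q).trans ?_
    have hQdeg' : (Q.totalDegree : ℝ) ≤ i + k := by exact_mod_cast hQdeg
    have h0 : 0 ≤ (7 * ((Q.totalDegree : ℝ) + t) + j) ^ t := by positivity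
    calc (7 * ((Q.totalDegree : ℝ) + t) + j) ^ t * l1 Q ≤ (7 * ((Q.totalDegree : ℝ) + t) + j) ^ t * 1 := by
          gcongr
      _ ≤ (7 * ((i : ℝ) + k + t) + j) ^ t := by
          rw [mul_one]
          exact pow_le_pow_left₀ (by positivity) (by linarith) t
  have hU : l1 ((X 3 ^ (2 * n₁ + 1) * X 4 ^ n₂ : P₇) ^ j) ≤ 1 := by
    refine (wnorm_pow_le _ (by simp) _ _).trans ?_
    have h1 : wnorm (normRingSeminorm ℤ) (X 3 ^ (2 * n₁ + 1) * X 4 ^ n₂ : P₇) ≤ 1 := by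
      refine (wnorm_mul_le _ _ _).trans ?_
      have h1 := Chudnovsky.wnorm_X_pow_le (normRingSeminorm ℤ) (by simp) (3 : Fin 7) (2 * n₁ + 1)
      have h2 := Chudnovsky.wnorm_X_pow_le (normRingSeminorm ℤ) (by simp) (4 : Fin 7) n₂
      have h0 := wnorm_nonneg (normRingSeminorm ℤ) ((X 3 : P₇) ^ (2 * n₁ + 1))
      nlinarith
    exact pow_le_one₀ (wnorm_nonneg _ _) h1
  calc l1 ((X 3 ^ (2 * n₁ + 1) * X 4 ^ n₂ : P₇) ^ j * MvPolynomial.aeval (sval₀ n₁ n₂) P)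
      ≤ l1 ((X 3 ^ (2 * n₁ + 1) * X 4 ^ n₂ : P₇) ^ j) * l1 (MvPolynomial.aeval (sval₀ n₁ n₂) P) := wnorm_mul_le _ _ _
    _ ≤ 1 * (l1 P * (2 * (n₁ : ℝ) + n₂ + 2) ^ P.totalDegree) :=
        mul_le_mul hU (Chudnovsky.l1_aeval_le _ hM (l1_sval₀_le n₁ n₂) P) (wnorm_nonneg _ _) zero_le_one
    _ ≤ (7 * ((i : ℝ) + k + t) + j) ^ t * (2 * (n₁ : ℝ) + n₂ + 2) ^ (i + k + t) := by
        rw [one_mul]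
        exact mul_le_mul hl1P (pow_le_pow_right₀ hM hdegP) (by positivity) (by positivity)

end Bounds

end Tubbs

end Literature.NumberTheory.Transcendental
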